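import Summits.HodgeConjecture.CorCM.IrreducibleOddWeightsShadowModulesDefect
import HarnessLib

/-!
# Shadow modules, VIII: the PARITY CERTIFICATE — when the equivariant isomorphism between two irreducible shadow modules is
# unique up to scalars, four odd integers read off ONE reference isomorphism forbid interaction (model-free D₄ block)

COR-CM (cell `pub-hodgecm2`, binder seat `b16` gen 69, count-neutral claim ROW SPACES OVER THE COMMUTANT, file Q9 —
abstract `G`-set level, in the lane's own language; theorems only, no definition, no named fact, no `sorry`).  NEW as
stated, hence under `Summits/`.  HONEST FRAMING: file Q3b's interaction criterion («some equivariant `L` carries the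
partner's shadow to ours») combined with gen 68's 2-adic lemma `not_parallel_of_odd`; the uniqueness of the equivariant
isomorphism up to scalars (absolute irreducibility) is a HYPOTHESIS (`huniq`), verified per configuration on the finite
Galois model (this generation's census: `Hom_G(Anti(K₁), Anti(K₀))` is ONE-dimensional for 46 of the 49 positional base
pairs, and the certificate below exists for all 46 — `census-g69/d4block.json`); `HC_CM` is neither used nor asserted.

SETTING (Q3).  Shadows `w₀ ∈ A₀ ≤ ℚ^{Y₀}`, `w₁ ∈ A₁ ≤ ℚ^{Y₁}` in stable irreducible modules; a REFERENCE map
`L₀ : ℚ^{Y₁} → ℚ^{Y₀}`, equivariant and injective on `A₁` with `L₀(A₁) ⊆ A₀`, and `huniq`: every such map is `t·L₀` on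
`A₁`.  A PARITY CERTIFICATE for `(w₀, w₁)`: a vector `v ∈ A₁` with `L₀ v = w₀` and two points `y, y′ ∈ Y₁` with
`v(y) = α + β`, `v(y′) = α − β`, `w₁(y) = a`, `w₁(y′) = b`, all four of `α, β, a, b` ODD integers.

* **`typeRank_sigmaType_add_card_eq_of_parity_certificate`** — a parity certificate forbids interaction:
  `rank(Φ₀,Φ₁) + 2 = rank Φ₀ + rank Φ₁ + 1`.  (If `L w₁ = w₀` then `L = t L₀` on `A₁`, so `t w₁ = v`; evaluating at
  `y, y′` gives `(α+β, α−β) = t(a, b)` with odd entries — gen 68's `not_parallel_of_odd`.)  For the inflated towers over a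
  base pair the certificate is uniform in the odd type cosets (it only reads parities), so ONE certificate per base pair
  settles «odd × odd indices are additive» for all types at all odd indices — the dyadic law of gen 68's census, now with
  46 certificates.  `exists_smul_of_forall_endo_smul` derives `huniq` from «every equivariant endomorphism of `A₀` is a
  scalar» (absolute irreducibility); `typeRank_sigmaType_add_card_eq_of_parity_certificate'` is the resulting form.

## References

* [Gordon1999HodgeAVSurvey] B. B. Gordon, *A survey of the Hodge conjecture for abelian varieties*, §3 Theorem, 7.5–7.7,
  9.4.3.
* [Serre1977] J.-P. Serre, *Linear Representations of Finite Groups*, GTM 42, §2.2.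
* [Lang2002] S. Lang, *Algebra*, 3rd ed., XVII §3.
-/

set_option autoImplicit false

noncomputable section

open scoped BigOperators Classical

universe u v v' v'' w

namespace Summit.HodgeConjecture.CorCM.IrrOdd

open Literature.NumberTheory.ComplexMultiplication

variable {G : Type w} [Group G] {Y₀ : Type v'} [MulAction G Y₀] [Fintype Y₀] [DecidableEq Y₀]
  {Y₁ : Type v''} [MulAction G Y₁] [Fintype Y₁] [DecidableEq Y₁]
  {I : Type u} {E : I → Type v} [∀ i, MulAction G (E i)] [∀ i, Fintype (E i)] [Fintype I] [∀ i, Nonempty (E i)]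

omit [Fintype Y₀] [DecidableEq Y₀] [Fintype Y₁] [DecidableEq Y₁] in
/-- **UNIQUENESS OF THE EQUIVARIANT ISOMORPHISM UP TO SCALARS**: if every equivariant endomorphism of the stable
irreducible `A₀` acts on it as a scalar (absolute irreducibility), then any two maps `L₀, L : ℚ^{Y₁} → ℚ^{Y₀}` that are
equivariant and injective on the stable irreducible `A₁` with values in `A₀` differ by a scalar on `A₁`
(`L = t·L₀` on `A₁`) — the hypothesis `huniq` below. [cite: Serre1977, §2.2] [cite: Lang2002, XVII §1 Prop. 1.1] -/
theorem exists_smul_of_forall_endo_smul {A₀ : Submodule ℚ (Y₀ → ℚ)} {A₁ : Submodule ℚ (Y₁ → ℚ)}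
    (hirr₀ : ∀ W : Submodule ℚ (Y₀ → ℚ), W ≤ A₀ → W ≠ ⊥ →
      (∀ (k : G) (f : Y₀ → ℚ), f ∈ W → (fun y => f (k • y)) ∈ W) → W = A₀)
    (hAst₁ : ∀ (k : G) (a : Y₁ → ℚ), a ∈ A₁ → (fun y => a (k • y)) ∈ A₁)
    (habs₀ : ∀ φ : (Y₀ → ℚ) →ₗ[ℚ] (Y₀ → ℚ), (∀ a ∈ A₀, φ a ∈ A₀) →
      (∀ (k : G) (a : Y₀ → ℚ), a ∈ A₀ → φ (fun y => a (k • y)) = fun y => φ a (k • y)) →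
      ∃ t : ℚ, ∀ a ∈ A₀, φ a = t • a)
    (L₀ L : (Y₁ → ℚ) →ₗ[ℚ] (Y₀ → ℚ)) (hL₀A : ∀ f ∈ A₁, L₀ f ∈ A₀) (hL₀inj : ∀ f ∈ A₁, L₀ f = 0 → f = 0)
    (hL₀eq : ∀ (k : G) (f : Y₁ → ℚ), f ∈ A₁ → L₀ (fun y => f (k • y)) = fun y => L₀ f (k • y))
    (hLA : ∀ f ∈ A₁, L f ∈ A₀)
    (hLeq : ∀ (k : G) (f : Y₁ → ℚ), f ∈ A₁ → L (fun y => f (k • y)) = fun y => L f (k • y)) :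
    ∃ t : ℚ, ∀ f ∈ A₁, L f = t • L₀ f := by
  by_cases hA₁ : A₁ = ⊥
  · refine ⟨0, fun f hf => ?_⟩
    rw [hA₁] at hf
    rw [(Submodule.mem_bot ℚ).1 hf, map_zero, map_zero, smul_zero]
  -- `L₀(A₁) = A₀`
  have hrange : A₁.map L₀ = A₀ := by
    refine hirr₀ _ (fun a ha => ?_) (fun h => hA₁ ?_) (fun k a ha => ?_)
    · obtain ⟨f, hf, rfl⟩ := ha
      exact hL₀A f hf
    · rw [Submodule.eq_bot_iff] at h ⊢
      exact fun f hf => hL₀inj f hf (h _ ⟨f, hf, rfl⟩)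
    · obtain ⟨f, hf, rfl⟩ := ha
      exact ⟨fun y => f (k • y), hAst₁ k f hf, hL₀eq k f hf⟩
  have hinj : Function.Injective (L₀.domRestrict A₁) := by
    intro f f' hff'
    apply Subtype.ext
    have hsub : L₀ ((f : Y₁ → ℚ) - f') = 0 := by
      rw [map_sub, sub_eq_zero]
      exact hff'
    exact sub_eq_zero.1 (hL₀inj _ (A₁.sub_mem f.2 f'.2) hsub)
  have hrange' : LinearMap.range (L₀.domRestrict A₁) = A₀ := by rw [LinearMap.range_domRestrict, hrange]
  -- `φ = L ∘ L₀⁻¹` on `A₀`, extended to `ℚ^{Y₀}`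
  let e := LinearEquiv.ofInjective (L₀.domRestrict A₁) hinj
  obtain ⟨φ, hφ⟩ := LinearMap.exists_extend
    ((L.domRestrict A₁) ∘ₗ e.symm.toLinearMap ∘ₗ (LinearEquiv.ofEq _ _ hrange').symm.toLinearMap)
  -- `φ (L₀ f) = L f` for `f ∈ A₁`
  have hφL : ∀ f ∈ A₁, φ (L₀ f) = L f := fun f hf => by
    have hmem : L₀ f ∈ A₀ := hL₀A f hf
    have h1 := LinearMap.congr_fun hφ ⟨L₀ f, hmem⟩
    simp only [LinearMap.coe_comp, Function.comp_apply, Submodule.coe_subtype, LinearEquiv.coe_coe,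
      LinearMap.domRestrict_apply] at h1
    rw [h1]
    -- `(ofEq ..).symm ⟨L₀ f, _⟩ = ⟨L₀ f, _⟩ = e ⟨f, hf⟩`, so `e.symm` of it is `⟨f, hf⟩`
    have h2 : (LinearEquiv.ofEq _ _ hrange').symm ⟨L₀ f, hmem⟩ = e ⟨f, hf⟩ := by
      apply Subtype.ext
      simp [e, LinearEquiv.ofEq_symm, LinearEquiv.coe_ofEq_apply, LinearEquiv.ofInjective_apply]
    rw [h2, LinearEquiv.symm_apply_apply]
  obtain ⟨t, ht⟩ := habs₀ φ (fun a ha => by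
      obtain ⟨f, hf, rfl⟩ : a ∈ A₁.map L₀ := by rw [hrange]; exact ha
      rw [hφL f hf]; exact hLA f hf)
    (fun k a ha => by
      obtain ⟨f, hf, rfl⟩ : a ∈ A₁.map L₀ := by rw [hrange]; exact ha
      rw [← hL₀eq k f hf, hφL _ (hAst₁ k f hf), hLeq k f hf, hφL f hf])
  exact ⟨t, fun f hf => by rw [← hφL f hf, ht _ (hL₀A f hf)]⟩

/-- **A PARITY CERTIFICATE FORBIDS INTERACTION.**  Two slots with equivariant pivots refining the trace classes, shadows
in stable irreducible modules `A₀, A₁`; a reference map `L₀` (equivariant and injective on `A₁`, into `A₀`) such that every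
such map is a scalar multiple of `L₀` on `A₁`; a vector `v ∈ A₁` with `L₀ v = w₀` and points `y, y′` with
`v(y) = α + β`, `v(y′) = α − β`, `w₁(y) = a`, `w₁(y′) = b`, `α, β, a, b` odd ⟹ `rank(Φ₀,Φ₁) + 2 = rank Φ₀ + rank Φ₁ + 1`.
[cite: Gordon1999HodgeAVSurvey, §3 Theorem, 7.5–7.7 and 9.4.3] [cite: Lang2002, XVII §3] -/
theorem typeRank_sigmaType_add_card_eq_of_parity_certificate {ρ : G} {Φ : ∀ i, Set (E i)}
    (h : ∀ i, IsCMTypeWith ρ (Φ i)) {i₀ i₁ : I} (hI : ∀ j, j = i₀ ∨ j = i₁) (h01 : i₀ ≠ i₁)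
    (r₀ : E i₀ → Y₀) (r₁ : E i₁ → Y₁) (hr₀ : ∀ (g : G) (x : E i₀), r₀ (g • x) = g • r₀ x)
    (hr₁ : ∀ (g : G) (x : E i₁), r₁ (g • x) = g • r₁ x)
    (hfine₀ : ∀ x x' : E i₀, r₀ x = r₀ x' → ∃ n : G, (∀ y : E i₁, n • y = y) ∧ n • x = x')
    (hfine₁ : ∀ x x' : E i₁, r₁ x = r₁ x' → ∃ n : G, (∀ y : E i₀, n • y = y) ∧ n • x = x')
    {A₀ : Submodule ℚ (Y₀ → ℚ)} {A₁ : Submodule ℚ (Y₁ → ℚ)}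
    (hAst₀ : ∀ (k : G) (a : Y₀ → ℚ), a ∈ A₀ → (fun y => a (k • y)) ∈ A₀)
    (hirr₀ : ∀ W : Submodule ℚ (Y₀ → ℚ), W ≤ A₀ → W ≠ ⊥ →
      (∀ (k : G) (f : Y₀ → ℚ), f ∈ W → (fun y => f (k • y)) ∈ W) → W = A₀)
    (hAst₁ : ∀ (k : G) (a : Y₁ → ℚ), a ∈ A₁ → (fun y => a (k • y)) ∈ A₁)
    (hirr₁ : ∀ W : Submodule ℚ (Y₁ → ℚ), W ≤ A₁ → W ≠ ⊥ →
      (∀ (k : G) (f : Y₁ → ℚ), f ∈ W → (fun y => f (k • y)) ∈ W) → W = A₁)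
    (hw₀A : (fun y : Y₀ => ∑ x ∈ Finset.univ.filter (fun x => r₀ x = y), antiVec (Φ i₀) (1 : G) x) ∈ A₀)
    (hw₁A : (fun y : Y₁ => ∑ x ∈ Finset.univ.filter (fun x => r₁ x = y), antiVec (Φ i₁) (1 : G) x) ∈ A₁)
    (L₀ : (Y₁ → ℚ) →ₗ[ℚ] (Y₀ → ℚ)) (hL₀inj : ∀ f ∈ A₁, L₀ f = 0 → f = 0)
    (huniq : ∀ L : (Y₁ → ℚ) →ₗ[ℚ] (Y₀ → ℚ), (∀ f ∈ A₁, L f ∈ A₀) → (∀ f ∈ A₁, L f = 0 → f = 0) →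
      (∀ (k : G) (f : Y₁ → ℚ), f ∈ A₁ → L (fun y => f (k • y)) = fun y => L f (k • y)) →
      ∃ t : ℚ, ∀ f ∈ A₁, L f = t • L₀ f)
    {v : Y₁ → ℚ} (hv : v ∈ A₁)
    (hL₀v : L₀ v = fun y : Y₀ => ∑ x ∈ Finset.univ.filter (fun x => r₀ x = y), antiVec (Φ i₀) (1 : G) x)
    (y y' : Y₁) {α β a b : ℤ} (hα : Odd α) (hβ : Odd β) (ha : Odd a) (hb : Odd b)
    (hvy : v y = α + β) (hvy' : v y' = α - β)
    (hay : ∑ x ∈ Finset.univ.filter (fun x => r₁ x = y), antiVec (Φ i₁) (1 : G) x = a)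
    (hby : ∑ x ∈ Finset.univ.filter (fun x => r₁ x = y'), antiVec (Φ i₁) (1 : G) x = b) :
    typeRank G (sigmaType Φ) + Fintype.card I = (∑ i, typeRank G (Φ i)) + 1 := by
  have hcard : Fintype.card I = 2 := by
    rw [← Finset.card_univ, show (Finset.univ : Finset I) = {i₀, i₁} from Finset.ext fun j => by
      simpa only [Finset.mem_univ, Finset.mem_insert, Finset.mem_singleton, true_iff] using hI j,
      Finset.card_pair h01]
  -- either additive, or the criterion produces an equivariant `L` carrying `w₁` to `w₀`
  rcases typeRank_add_typeRank_eq_or_eq_add_finrank_of_irreducible h hI h01 r₀ r₁ hr₀ hr₁ hfine₀ hfine₁ hAst₀ hirr₀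
    hAst₁ hirr₁ hw₀A hw₁A with hadd | hint
  · rw [sum_eq_add_of_pair _ hI h01, hcard]
    omega
  · exfalso
    -- `A₀ ≠ 0` (it contains `w₀ = L₀ v`; if `w₀ = 0` the interacting branch is impossible anyway)
    have hne : typeRank G (Φ i₀) + typeRank G (Φ i₁) ≠ typeRank G (sigmaType Φ) + 1 := by
      intro heq
      rw [heq] at hint
      -- then `finrank A₀ = 0`, so `w₀ = 0`, so `v = 0`, contradicting `v y = α + β` with ... not needed: use the criterion
      have hA0 : Module.finrank ℚ A₀ = 0 := by omega
      have hw0 : (fun y : Y₀ => ∑ x ∈ Finset.univ.filter (fun x => r₀ x = y), antiVec (Φ i₀) (1 : G) x) = 0 := by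
        have : A₀ = ⊥ := Submodule.finrank_eq_zero.1 hA0
        rw [this] at hw₀A
        exact (Submodule.mem_bot ℚ).1 hw₀A
      have hv0 : v = 0 := hL₀inj v hv (by rw [hL₀v, hw0])
      have h1 : (α : ℚ) + β = 0 := by rw [← hvy, hv0]; rfl
      have h2 : (α : ℚ) - β = 0 := by rw [← hvy', hv0]; rfl
      have h3 : (α : ℚ) = 0 := by linarith
      have h4 : α = 0 := by exact_mod_cast h3
      rw [h4] at hα
      exact (Int.not_odd_iff_even.2 (by decide)) hα
    obtain ⟨hw₀0, L, hLA, hLinj, hLeq, hLw⟩ := (typeRank_add_typeRank_ne_iff_of_irreducible h hI h01 r₀ r₁ hr₀ hr₁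
      hfine₀ hfine₁ hAst₀ hirr₀ hAst₁ hirr₁ hw₀A hw₁A).1 hne
    obtain ⟨t, ht⟩ := huniq L hLA hLinj hLeq
    -- `L₀ (t • w₁) = L w₁ = w₀ = L₀ v`, so `t • w₁ = v` by injectivity on `A₁`
    have htw : t • (fun y : Y₁ => ∑ x ∈ Finset.univ.filter (fun x => r₁ x = y), antiVec (Φ i₁) (1 : G) x) = v := by
      have hdiff := hL₀inj (t • (fun y : Y₁ => ∑ x ∈ Finset.univ.filter (fun x => r₁ x = y),
          antiVec (Φ i₁) (1 : G) x) - v) (A₁.sub_mem (A₁.smul_mem t hw₁A) hv) (by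
        rw [map_sub, map_smul, ← ht _ hw₁A, hLw, hL₀v, sub_self])
      exact sub_eq_zero.1 hdiff
    -- evaluate at `y` and `y'`
    have e1 : t * (a : ℚ) = α + β := by
      have := congrFun htw y
      rw [Pi.smul_apply, smul_eq_mul, hay] at this
      rw [this, hvy]
    have e2 : t * (b : ℚ) = α - β := by
      have := congrFun htw y'
      rw [Pi.smul_apply, smul_eq_mul, hby] at this
      rw [this, hvy']
    exact Summit.HodgeConjecture.CorCM.not_parallel_of_odd hα hβ ha hb (t / 2) ⟨by linarith, by linarith⟩

/-- **PARITY CERTIFICATE, ABSOLUTELY IRREDUCIBLE FORM**: as above, with the uniqueness of the isomorphism DERIVED from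
«every equivariant endomorphism of `A₀` is a scalar» (`exists_smul_of_forall_endo_smul`).
[cite: Gordon1999HodgeAVSurvey, §3 Theorem, 7.5–7.7 and 9.4.3] [cite: Serre1977, §2.2] -/
theorem typeRank_sigmaType_add_card_eq_of_parity_certificate' {ρ : G} {Φ : ∀ i, Set (E i)}
    (h : ∀ i, IsCMTypeWith ρ (Φ i)) {i₀ i₁ : I} (hI : ∀ j, j = i₀ ∨ j = i₁) (h01 : i₀ ≠ i₁)
    (r₀ : E i₀ → Y₀) (r₁ : E i₁ → Y₁) (hr₀ : ∀ (g : G) (x : E i₀), r₀ (g • x) = g • r₀ x)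
    (hr₁ : ∀ (g : G) (x : E i₁), r₁ (g • x) = g • r₁ x)
    (hfine₀ : ∀ x x' : E i₀, r₀ x = r₀ x' → ∃ n : G, (∀ y : E i₁, n • y = y) ∧ n • x = x')
    (hfine₁ : ∀ x x' : E i₁, r₁ x = r₁ x' → ∃ n : G, (∀ y : E i₀, n • y = y) ∧ n • x = x')
    {A₀ : Submodule ℚ (Y₀ → ℚ)} {A₁ : Submodule ℚ (Y₁ → ℚ)}
    (hAst₀ : ∀ (k : G) (a : Y₀ → ℚ), a ∈ A₀ → (fun y => a (k • y)) ∈ A₀)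
    (hirr₀ : ∀ W : Submodule ℚ (Y₀ → ℚ), W ≤ A₀ → W ≠ ⊥ →
      (∀ (k : G) (f : Y₀ → ℚ), f ∈ W → (fun y => f (k • y)) ∈ W) → W = A₀)
    (hAst₁ : ∀ (k : G) (a : Y₁ → ℚ), a ∈ A₁ → (fun y => a (k • y)) ∈ A₁)
    (hirr₁ : ∀ W : Submodule ℚ (Y₁ → ℚ), W ≤ A₁ → W ≠ ⊥ →
      (∀ (k : G) (f : Y₁ → ℚ), f ∈ W → (fun y => f (k • y)) ∈ W) → W = A₁)
    (habs₀ : ∀ φ : (Y₀ → ℚ) →ₗ[ℚ] (Y₀ → ℚ), (∀ a ∈ A₀, φ a ∈ A₀) →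
      (∀ (k : G) (a : Y₀ → ℚ), a ∈ A₀ → φ (fun y => a (k • y)) = fun y => φ a (k • y)) →
      ∃ t : ℚ, ∀ a ∈ A₀, φ a = t • a)
    (hw₀A : (fun y : Y₀ => ∑ x ∈ Finset.univ.filter (fun x => r₀ x = y), antiVec (Φ i₀) (1 : G) x) ∈ A₀)
    (hw₁A : (fun y : Y₁ => ∑ x ∈ Finset.univ.filter (fun x => r₁ x = y), antiVec (Φ i₁) (1 : G) x) ∈ A₁)
    (L₀ : (Y₁ → ℚ) →ₗ[ℚ] (Y₀ → ℚ)) (hL₀A : ∀ f ∈ A₁, L₀ f ∈ A₀) (hL₀inj : ∀ f ∈ A₁, L₀ f = 0 → f = 0)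
    (hL₀eq : ∀ (k : G) (f : Y₁ → ℚ), f ∈ A₁ → L₀ (fun y => f (k • y)) = fun y => L₀ f (k • y))
    {v : Y₁ → ℚ} (hv : v ∈ A₁)
    (hL₀v : L₀ v = fun y : Y₀ => ∑ x ∈ Finset.univ.filter (fun x => r₀ x = y), antiVec (Φ i₀) (1 : G) x)
    (y y' : Y₁) {α β a b : ℤ} (hα : Odd α) (hβ : Odd β) (ha : Odd a) (hb : Odd b)
    (hvy : v y = α + β) (hvy' : v y' = α - β)
    (hay : ∑ x ∈ Finset.univ.filter (fun x => r₁ x = y), antiVec (Φ i₁) (1 : G) x = a)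
    (hby : ∑ x ∈ Finset.univ.filter (fun x => r₁ x = y'), antiVec (Φ i₁) (1 : G) x = b) :
    typeRank G (sigmaType Φ) + Fintype.card I = (∑ i, typeRank G (Φ i)) + 1 :=
  typeRank_sigmaType_add_card_eq_of_parity_certificate h hI h01 r₀ r₁ hr₀ hr₁ hfine₀ hfine₁ hAst₀ hirr₀ hAst₁ hirr₁
    hw₀A hw₁A L₀ hL₀inj
    (fun L hLA _ hLeq => exists_smul_of_forall_endo_smul hirr₀ hAst₁ habs₀ L₀ L hL₀A hL₀inj hL₀eq hLA hLeq)
    hv hL₀v y y' hα hβ ha hb hvy hvy' hay hby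

end Summit.HodgeConjecture.CorCM.IrrOdd

end
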